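import Literature.AlgebraicGeometry.Resolution.EmbeddedResolutionCurvesInSurfaces
import Literature.AlgebraicGeometry.Resolution.GiraudLogJacobianIdeal
import Literature.AlgebraicGeometry.Resolution.EmbeddedCurvePointBlowups
import Literature.AlgebraicGeometry.Resolution.RegularBlowup
import Literature.AlgebraicGeometry.Resolution.PointCentrePermissible
import Literature.AlgebraicGeometry.Resolution.SigmaMaxEliminationInDim
import Literature.AlgebraicGeometry.Resolution.CofinalityFromPrincipalization
import Literature.AlgebraicGeometry.Resolution.ExcellentRingsFieldProofs
import HarnessLib

/-!
# [OURS · L W8.1 · T2 brick B8] PHASE A of `Giraud24OverField`: F-75c (Stacks 0BIC, locus form) on `Z := E(f)` makes `E(f)` a strict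
# normal crossings divisor after a composition of point blow-ups CENTRED OVER `E(f)` — modulo B2 (`E(f∘e) = e⁻¹E(f)` for a point blow-up
# `e` centred in `E(f)`), taken as an explicit hypothesis

Programme `PROGRAMME-clean-dim2` / T2 (res-L0-w81-pv-2 g5, `HOME/L/res-L0-w81-pv-2/g5/T2-ARCHITECTURE.md` §2 B8), crux
`stmt-ResolutionOfSingularities-0549` line via-clean-models, stub `stub_cleanModels` (= stmt-…-15917); `--supports … --as helper` by
res-L1-s13-pv-1 g7 (custody DEAL #53 (1)).  OURS glue; the only published input is the NAMED FACT F-75c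
`Stacks0BIC_embeddedResolutionCurvesInSurfaces_locus` (statement-only, p544210), taken as a hypothesis `h75c`; nothing here is a
statement of H. Hironaka's manuscript; AI-written, weaker than expert review.

**B8 (Phase A).** `X` Noetherian, regular, excellent, `topologicalKrullDim X = 2`, `f ∈ Γ(X, 𝒪_X)` with `E(f) := derivCriticalSet X f`
(Giraud's `E(f)`, tree `GiraudLogJacobianIdeal`, p557089) CLOSED and NOWHERE DENSE (brick B2, first half).  Apply F-75c to the reduced
ideal sheaf `Z := vanishingIdeal E(f)` (`supp Z = E(f)`): a composition `π₁ : X₁ → X` of blowing ups at closed points LYING OVER `E(f)` with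
`π₁⁻¹E(f)` a strict normal crossings divisor.  Brick B2 (second half: for a blow-up `e` of a locally Noetherian regular `Y` at a closed
point `y ∈ E(g)`, `E(e^*g) = e⁻¹E(g)`) is NOT in the tree yet (`lean search derivCriticalSet` = the definition only); it enters as the
explicit ∀-hypothesis `hB2` in single-step form and is propagated along the composition by induction (`IsPointBlowupComposition.rec`),
each centre lying in the current `E` because it lies over `E(f)`; regularity of the stages is carried along (`IsBlowup.isRegular_of_
isRegular_subscheme` + `isRegular_subscheme_vanishingIdeal_singleton`).  Conclusion: `E(π₁^*f) = π₁⁻¹E(f)` is a strict normal crossings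
divisor of the regular scheme `X₁`, so Giraud's condition (*) holds at EVERY point of `E(π₁^*f)`; `π₁` is proper and `X₁` integral
when `X` is (`IsPointBlowupComposition.isProper/isIntegral`).

* `isRegular_of_isPointBlowupComposition` — every stage of a composition of point blowing ups of a regular locally Noetherian scheme is regular;
* `appTop_comp_apply`, `preimage_comp` — bookkeeping;
* `derivCriticalSet_eq_preimage_of_isPointBlowupComposition` — `E(π^*f) = π⁻¹E(f)` along any composition centred over `E(f)`, modulo `hB2`;
* **`exists_phaseA`** — the statement above; **`phaseA_of_B2`** — the same in the binders of the T2 skeleton's `stub_phaseA` (l.f.t. over a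
  field, compact: Noetherian + excellent derived), conclusion = the stub's triple; `isIntegral_of_phaseA` (rider).
-/

set_option linter.dupNamespace false -- mandated namespace `Summit.<Summit>.<Problem>` of this single-conjunct summit

noncomputable section

open CategoryTheory AlgebraicGeometry TopologicalSpace Topology
open Literature.AlgebraicGeometry.Resolution
open Scheme.IdealSheafData

namespace Summit.ResolutionOfSingularities.ResolutionOfSingularities.Theorems.RadicialJung.CleanModels

universe u

/-! ## § 1 Regularity along compositions of point blowing ups -/

/-- **Every stage of a composition of blowing ups at closed points of a regular locally Noetherian scheme is regular** (a reduced closed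
point is a regular centre, `isRegular_subscheme_vanishingIdeal_singleton`; blowing up a regular scheme in a regular centre keeps it regular,
Liu Thm. 8.1.19 (a), tree `IsBlowup.isRegular_of_isRegular_subscheme`). [cite: Liu2002, Thm. 8.1.19 (a)] -/
theorem isRegular_of_isPointBlowupComposition {X : Scheme.{u}} [IsLocallyNoetherian X] (hX : Scheme.IsRegular X) {T : Set X} :
    ∀ {X' : Scheme.{u}} {π : X' ⟶ X}, IsPointBlowupComposition T π → Scheme.IsRegular X' := by
  intro X' π h
  induction h with
  | nil => exact hX
  | cons τ σ x' hx' hσ hne hT hτ ih =>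
    haveI : IsLocallyNoetherian _ := hσ.isLocallyNoetherian
    exact hτ.isRegular_of_isRegular_subscheme ih (isRegular_subscheme_vanishingIdeal_singleton hx')

/-! ## § 2 `E(π^*f) = π⁻¹E(f)` along a composition centred over `E(f)`, modulo B2 -/

/-- Pull-back of a global section along a composite. [folklore] -/
theorem appTop_comp_apply {X X' X'' : Scheme.{u}} (τ : X'' ⟶ X') (σ : X' ⟶ X) (f : Γ(X, ⊤)) :
    (τ ≫ σ).appTop f = τ.appTop (σ.appTop f) := by
  rw [Scheme.Hom.comp_appTop, CommRingCat.comp_apply]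

/-- Preimage along a composite. [folklore] -/
theorem preimage_comp {X X' X'' : Scheme.{u}} (τ : X'' ⟶ X') (σ : X' ⟶ X) (S : Set X) :
    (τ ≫ σ) ⁻¹' S = τ ⁻¹' (σ ⁻¹' S) := by
  ext x
  simp only [Set.mem_preimage, Scheme.Hom.comp_apply]

/-- **`E(π^*f) = π⁻¹E(f)` along every composition of point blowing ups centred over `E(f)`** of a regular locally Noetherian scheme,
modulo brick B2 in single-step form (`hB2`): each centre `x'` lies over `E(f)`, hence (induction hypothesis) in the current `E`, so B2
applies; regularity of the stages by § 1. [folklore] -/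
theorem derivCriticalSet_eq_preimage_of_isPointBlowupComposition {X : Scheme.{u}} [IsLocallyNoetherian X]
    (hX : Scheme.IsRegular X) (f : Γ(X, ⊤))
    (hB2 : ∀ {Y Y' : Scheme.{u}} [IsLocallyNoetherian Y] (e : Y' ⟶ Y) (g : Γ(Y, ⊤)) (y : Y) (hy : IsClosed ({y} : Set Y)),
      Scheme.IsRegular Y → ({y} : Set Y) ≠ Set.univ → y ∈ derivCriticalSet Y g →
      IsBlowup e (vanishingIdeal ⟨{y}, hy⟩) → derivCriticalSet Y' (e.appTop g) = e ⁻¹' derivCriticalSet Y g) :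
    ∀ {X' : Scheme.{u}} {π : X' ⟶ X}, IsPointBlowupComposition (derivCriticalSet X f) π →
      derivCriticalSet X' (π.appTop f) = π ⁻¹' derivCriticalSet X f := by
  intro X' π h
  induction h with
  | nil =>
    rw [Scheme.Hom.id_appTop]
    rfl
  | cons τ σ x' hx' hσ hne hT hτ ih =>
    haveI : IsLocallyNoetherian _ := hσ.isLocallyNoetherian
    have hreg := isRegular_of_isPointBlowupComposition hX hσ
    have hx'E : x' ∈ derivCriticalSet _ (σ.appTop f) := by
      rw [ih]
      exact hT
    rw [appTop_comp_apply, preimage_comp, hB2 τ (σ.appTop f) x' hx' hreg hne hx'E hτ, ih]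

/-! ## § 3 Phase A -/

/-- **B8 — PHASE A (modulo F-75c and B2).** For `X` Noetherian, regular, excellent of dimension `2` and `f ∈ Γ(X, 𝒪_X)` whose critical set
`E(f)` is closed and nowhere dense, F-75c applied to `Z := vanishingIdeal E(f)` yields a composition `π₁ : X₁ → X` of blowing ups at
closed points lying over `E(f)` after which `E(π₁^*f) = π₁⁻¹E(f)` (B2, hypothesis `hB2`) is a strict normal crossings divisor — (*) at
every point of `E(π₁^*f)` —, `X₁` is regular, `π₁` proper, and the pulled-back reduced ideal of `E(f)` is an effective Cartier divisor.
[cite: StacksProject, Tag 0BIC (Lemma 54.15.6)] [cite: Giraud1983, 2.2 (*) and Thm. 2.4, Phase A] -/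
theorem exists_phaseA (h75c : Stacks0BIC_embeddedResolutionCurvesInSurfaces_locus.{u}) (X : Scheme.{u}) [IsNoetherian X]
    (hX : Scheme.IsRegular X) (hexc : Scheme.IsExcellent X) (hdim : topologicalKrullDim X = 2) (f : Γ(X, ⊤))
    (hEcl : IsClosed (derivCriticalSet X f)) (hEnd : IsNowhereDense (derivCriticalSet X f))
    (hB2 : ∀ {Y Y' : Scheme.{u}} [IsLocallyNoetherian Y] (e : Y' ⟶ Y) (g : Γ(Y, ⊤)) (y : Y) (hy : IsClosed ({y} : Set Y)),
      Scheme.IsRegular Y → ({y} : Set Y) ≠ Set.univ → y ∈ derivCriticalSet Y g →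
      IsBlowup e (vanishingIdeal ⟨{y}, hy⟩) → derivCriticalSet Y' (e.appTop g) = e ⁻¹' derivCriticalSet Y g) :
    ∃ (X₁ : Scheme.{u}) (π₁ : X₁ ⟶ X), IsPointBlowupComposition (derivCriticalSet X f) π₁ ∧
      derivCriticalSet X₁ (π₁.appTop f) = π₁ ⁻¹' derivCriticalSet X f ∧
      IsStrictNormalCrossingsDivisor X₁ (derivCriticalSet X₁ (π₁.appTop f)) ∧
      (∀ ξ ∈ derivCriticalSet X₁ (π₁.appTop f), IsStrictNormalCrossingsAt X₁ (derivCriticalSet X₁ (π₁.appTop f)) ξ) ∧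
      Scheme.IsRegular X₁ ∧ IsProper π₁ ∧
      IsEffectiveCartier ((vanishingIdeal (⟨derivCriticalSet X f, hEcl⟩ : Closeds X)).comap π₁) := by
  set Z : X.IdealSheafData := vanishingIdeal ⟨derivCriticalSet X f, hEcl⟩ with hZdef
  have hZ : (Z.support : Set X) = derivCriticalSet X f := by
    rw [hZdef, coe_support_vanishingIdeal]
    rfl
  obtain ⟨X₁, π₁, hπ, hcart, hsnc⟩ := h75c X Z hX hexc hdim (by rw [hZ]; exact hEnd)
  rw [hZ] at hπ hsnc
  have hE := derivCriticalSet_eq_preimage_of_isPointBlowupComposition hX f hB2 hπ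
  refine ⟨X₁, π₁, hπ, hE, ?_, ?_, isRegular_of_isPointBlowupComposition hX hπ, hπ.isProper inferInstance, hcart⟩
  · rw [hE]
    exact hsnc
  · intro ξ hξ
    rw [hE] at hξ ⊢
    exact hsnc.isStrictNormalCrossingsAt hξ

/-- **B8 in the binders of the T2 skeleton's `stub_phaseA`** (res-L0-w81-pv-2 g5, `T2Skeleton.lean`): `X` integral, compact, locally of
finite type over a field `k`, regular of dimension `2` — Noetherian and EXCELLENT for free (`Scheme.IsExcellent.of_locallyOfFiniteType`, a
field being an excellent ring) —, modulo brick B2 supplied as the three hypotheses `hEcl` (E(f) closed), `hEnd` (E(f) nowhere dense, from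
`f ∉ K^p`) and `hB2` (E(e^*g) = e⁻¹E(g) for a point blow-up centred in E(g)); conclusion = the stub's triple verbatim.
[cite: StacksProject, Tag 0BIC (Lemma 54.15.6)] [cite: Giraud1983, Thm. 2.4 (proof, Phase A)] -/
theorem phaseA_of_B2 (h75c : Stacks0BIC_embeddedResolutionCurvesInSurfaces_locus.{u}) (k : Type u) [Field k]
    (X : Scheme.{u}) [CompactSpace X] (q : X ⟶ Spec (.of k)) [LocallyOfFiniteType q]
    (hreg : Scheme.IsRegular X) (hdim : topologicalKrullDim X = 2) (f : Γ(X, ⊤))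
    (hEcl : IsClosed (derivCriticalSet X f)) (hEnd : IsNowhereDense (derivCriticalSet X f))
    (hB2 : ∀ {Y Y' : Scheme.{u}} [IsLocallyNoetherian Y] (e : Y' ⟶ Y) (g : Γ(Y, ⊤)) (y : Y) (hy : IsClosed ({y} : Set Y)),
      Scheme.IsRegular Y → ({y} : Set Y) ≠ Set.univ → y ∈ derivCriticalSet Y g →
      IsBlowup e (vanishingIdeal ⟨{y}, hy⟩) → derivCriticalSet Y' (e.appTop g) = e ⁻¹' derivCriticalSet Y g) :
    ∃ (X₁ : Scheme.{u}) (π : X₁ ⟶ X), IsPointBlowupComposition (derivCriticalSet X f) π ∧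
      derivCriticalSet X₁ (π.appTop f) = π.base ⁻¹' derivCriticalSet X f ∧
      IsStrictNormalCrossingsDivisor X₁ (derivCriticalSet X₁ (π.appTop f)) := by
  haveI : IsLocallyNoetherian X := LocallyOfFiniteType.isLocallyNoetherian q
  haveI : IsNoetherian X := ⟨⟩
  have hexc : Scheme.IsExcellent X :=
    Scheme.IsExcellent.of_locallyOfFiniteType q (Scheme.isExcellent_Spec_of_isExcellentRing _ (isExcellentRing_of_field _))
  obtain ⟨X₁, π₁, hπ, hE, hsnc, -⟩ := exists_phaseA h75c X hreg hexc hdim f hEcl hEnd hB2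
  exact ⟨X₁, π₁, hπ, hE, hsnc⟩

/-- **Phase A keeps integrality** (rider): with `X` integral, the Phase-A model `X₁` is integral. [folklore] -/
theorem isIntegral_of_phaseA {X : Scheme.{u}} [IsIntegral X] {f : Γ(X, ⊤)} {X₁ : Scheme.{u}} {π₁ : X₁ ⟶ X}
    (hπ : IsPointBlowupComposition (derivCriticalSet X f) π₁) : IsIntegral X₁ :=
  hπ.isIntegral inferInstance

end Summit.ResolutionOfSingularities.ResolutionOfSingularities.Theorems.RadicialJung.CleanModels

end
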